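import Literature.MathematicalPhysics.QuantumFieldTheory.Balaban1983to89.HaarExpChartLocalFaceTransport
import Literature.MeasureTheory.Integral.SubmersionPushforwardDensity

/-!
# `Balaban1983to89.HaarExpChartMarginalDensity` — A NON-VACUITY INSTANCE OF THE LOCAL ROUTE: the restriction of a configuration of `G^B`
# to a sub-family of bonds `ι : B' ↪ B` HAS flat local faces at every configuration (its chart reading is the linear projection
# `A ↦ A ∘ ι`), hence MARGINALS OF CONTINUOUS DENSITIES UNDER PRODUCT HAAR MEASURE ARE CONTINUOUS — obtained through the whole chain
# ([Helgason2000] Ch. I Thm. 1.14 (13); [HormanderALPDO1] §6.1)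

statement-level skeleton of published theorems with citation tags; proofs where landed; nothing here is a claim
about the Yang–Mills mass gap

Cell `pub-ymgap` (YM-PLAN Track A), node N09 [B12] width seat `pub-ymgap-dag-n09-w2` (gen 4; helper lane, count-neutral).  A6 (№189) companion
of `HaarExpChartLocalFaceTransport` §5 (p618803): its hypothesis «flat local face of the chart-read map at every point» is INHABITED for a
concrete, non-trivial `M` — the bond restriction `U ↦ U ∘ ι` — by ONE application of the flat `C¹` engine
`Literature.MeasureTheory.Integral.SubmersionPushforward.exists_continuousOn_density_map_of_submersion` (p610570): the chart-read restriction
`A ↦ (b' ↦ Λ(Θ(A(ι b'))·U₀(ι b')·U₀(ι b')⁻¹))` coincides with the continuous linear surjection `A ↦ A ∘ ι` on the ball `B(0, s_C)`.  The chain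
(engine → bridge `flatFace_chartRead_of_engineFace` → `exists_continuous_density_pi_haar_of_flatLocalFaces`) then yields the classical fact that
integrating out the bond variables outside `ι(B')` takes a continuous density on `G^B` to a density on `G^{B'}` that is CONTINUOUS.

WHAT IS PROVED (namespace `…HaarExponentialChart.IsChartRep`; `G` compact, `μ` Haar and right invariant, `η` additive Haar on `𝔤 = C.lie`).
* `chartRead_restrict_eqOn_ball` — on `B(0, s_C)` the chart-read restriction is `A ↦ A ∘ ι`.
* `flatEngineFace_chartRead_restrict` — the flat `C¹`-engine face of the chart-read restriction at `0` (engine's own output shape).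
* ★★ `exists_continuous_marginal_pi_haar` — for every continuous `r ≥ 0` on `B → G` there is `g ≥ 0` CONTINUOUS on `B' → G` with
  `∫ r U · f (U ∘ ι) d(⊗_B μ) = ∫ g V · f V d(⊗_{B'} μ)` for every measurable real `f` (and the set identity).

HONEST SCOPE.  A sanity∕non-vacuity instance of the local route's hypotheses with an elementary `M`; nothing of Bałaban's (the averaging of
record is dag-n09-w4 g5's (M3r)-local claim); no estimate; N09 untouched; not a claim about the Clay problem.
-/

noncomputable section

open NormedSpace Set Function Filter Topology MeasureTheory
open scoped ENNReal NNReal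

namespace Literature.MathematicalPhysics.QuantumFieldTheory.Balaban1983to89.HaarExponentialChart

namespace IsChartRep

variable {𝔸 : Type*} [NormedRing 𝔸] [NormedAlgebra ℂ 𝔸] [CompleteSpace 𝔸]
variable {G : Type*} [Group G] [TopologicalSpace G] [IsTopologicalGroup G] [CompactSpace G]
variable {C : LogChart 𝔸} {ρ : G →* 𝔸} (h : IsChartRep C ρ)
variable {B B' : Type*} [Fintype B] [Fintype B']

omit [IsTopologicalGroup G] [CompactSpace G] [Fintype B'] in
/-- On the ball `B(0, s_C)` the chart reading of the bond restriction `U ↦ U ∘ ι` centred at `U₀` is the linear projection `A ↦ A ∘ ι`.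
[cite: Helgason2000, Ch. I §1 Thm. 1.14 (13) p. 96 (bookkeeping)] -/
theorem chartRead_restrict_eqOn_ball (ι : B' → B) (U₀ : B → G) {A : B → C.lie}
    (hA : A ∈ Metric.ball (0 : B → C.lie) (chartRadius C)) :
    (fun b' => h.logChart ((fun b => h.expChart (A b) * U₀ b) (ι b') * ((U₀ ∘ ι) b')⁻¹)) = A ∘ ι := by
  funext b'
  rw [mem_ball_zero_iff] at hA
  have hb : ‖A (ι b')‖ < chartRadius C := (norm_le_pi_norm A (ι b')).trans_lt hA
  simp only [Function.comp_apply, mul_inv_cancel_right]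
  exact h.logChart_expChart hb

variable [FiniteDimensional ℝ C.lie] [MeasurableSpace C.lie] [BorelSpace C.lie] [MeasurableSpace G] [BorelSpace G]
  (η : Measure C.lie) [η.IsAddHaarMeasure]

/-- **THE FLAT `C¹`-ENGINE FACE OF THE CHART-READ BOND RESTRICTION AT `0`** (the engine's own output shape, `M := U ↦ U ∘ ι`, `ι`
injective): the chart reading agrees near `0` with the continuous linear surjection `A ↦ A ∘ ι`, so it is `C¹` at `0` with onto differential,
and `SubmersionPushforward.exists_continuousOn_density_map_of_submersion` applies w.r.t. `⊗_B η`, `⊗_{B'} η`.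
[cite: HormanderALPDO1, §6.1, proof of Thm 6.1.2 (the projection case)] [cite: Helgason2000, Ch. I §1 Thm. 1.14 (13) p. 96] -/
theorem flatEngineFace_chartRead_restrict {ι : B' → B} (hι : Function.Injective ι) (U₀ : B → G) :
    ∃ O : Set (B → C.lie), IsOpen O ∧ (0 : B → C.lie) ∈ O ∧ ∃ D : Set (B' → C.lie), IsOpen D ∧
      (fun A : B → C.lie => (fun (V : B' → G) (b' : B') => h.logChart (V b' * ((U₀ ∘ ι) b')⁻¹))
        ((fun U : B → G => U ∘ ι) (fun b => h.expChart (A b) * U₀ b))) 0 ∈ D ∧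
      ∀ r : (B → C.lie) → ℝ, Measurable r → (∀ A, 0 ≤ r A) → ContinuousOn r O → (∃ C₀ : ℝ, ∀ A ∈ O, r A ≤ C₀) →
        (∀ A, A ∉ O → r A = 0) →
        ∃ I : (B' → C.lie) → ℝ, ContinuousOn I D ∧ (∀ w, 0 ≤ I w) ∧ ∀ A' : Set (B' → C.lie), MeasurableSet A' → A' ⊆ D →
          ((Measure.pi fun _ : B => η).withDensity fun A => ENNReal.ofReal (r A))
              ((fun A : B → C.lie => (fun (V : B' → G) (b' : B') => h.logChart (V b' * ((U₀ ∘ ι) b')⁻¹))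
                ((fun U : B → G => U ∘ ι) (fun b => h.expChart (A b) * U₀ b))) ⁻¹' A') =
            ∫⁻ w in A', ENNReal.ofReal (I w) ∂(Measure.pi fun _ : B' => η) := by
  haveI : T2Space G := h.isClosedEmbedding.isEmbedding.t2Space
  haveI := h.secondCountableTopology
  -- the chart-read restriction and the linear projection
  set ψ : (B → C.lie) → (B' → C.lie) := fun A => (fun (V : B' → G) (b' : B') => h.logChart (V b' * ((U₀ ∘ ι) b')⁻¹))
    ((fun U : B → G => U ∘ ι) (fun b => h.expChart (A b) * U₀ b)) with hψ
  set L : (B → C.lie) →L[ℝ] (B' → C.lie) :=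
    LinearMap.toContinuousLinearMap (LinearMap.funLeft ℝ C.lie ι) with hL
  have hLapply : ∀ A : B → C.lie, L A = A ∘ ι := fun A => rfl
  have heq : ψ =ᶠ[𝓝 (0 : B → C.lie)] L := by
    filter_upwards [Metric.isOpen_ball.mem_nhds (Metric.mem_ball_self (chartRadius_pos (C := C)))] with A hA
    rw [hLapply]
    exact h.chartRead_restrict_eqOn_ball ι U₀ hA
  have hψm : Measurable ψ :=
    measurable_pi_lambda _ fun b' =>
      h.measurable_logChart.comp (((h.measurable_expChart.comp (measurable_pi_apply (ι b'))).mul_const _).mul_const _)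
  have hψC : ContDiffAt ℝ 1 ψ 0 := L.contDiff.contDiffAt.congr_of_eventuallyEq heq
  have hψd : HasFDerivAt ψ L 0 := L.hasFDerivAt.congr_of_eventuallyEq heq
  have hsurjL : Function.Surjective L := by
    intro W
    refine ⟨Function.extend ι W 0, ?_⟩
    rw [hLapply]
    funext b'
    exact hι.extend_apply W 0 b'
  have hsurj : (fderiv ℝ ψ 0).range = ⊤ := by
    rw [hψd.fderiv]
    exact LinearMap.range_eq_top.2 hsurjL
  exact Literature.MeasureTheory.Integral.SubmersionPushforward.exists_continuousOn_density_map_of_submersion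
    (Measure.pi fun _ : B => η) (Measure.pi fun _ : B' => η) hψm hψC hsurj

variable (hlie : ∀ x ∈ C.lie, ∀ y ∈ C.lie, x * y - y * x ∈ C.lie) (μ : Measure G) [μ.IsHaarMeasure]

include h hlie η in
/-- ★★ **MARGINALS OF CONTINUOUS DENSITIES UNDER PRODUCT HAAR MEASURE ARE CONTINUOUS — through the local route.**  For `ι : B' → B`
injective and every continuous `r ≥ 0` on `B → G` there is `g ≥ 0`, CONTINUOUS on `B' → G`, with `(r·⊗μ)((· ∘ ι)⁻¹ S) = ∫⁻_S g d⊗μ` for every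
measurable `S` and `∫ r U · f (U ∘ ι) d(⊗_B μ) = ∫ g V · f V d(⊗_{B'} μ)` for every measurable real `f`.  (A6 companion of
`exists_continuous_density_pi_haar_of_flatLocalFaces`: its face hypothesis inhabited at every configuration by `flatEngineFace_chartRead_restrict`
through the bridge `flatFace_chartRead_of_engineFace`; `K := univ` on the compact source.)
[cite: HormanderALPDO1, §6.1, proof of Thm 6.1.2 (the projection case)] [cite: Helgason2000, Ch. I §1 Thm. 1.14 (13) p. 96] -/
theorem exists_continuous_marginal_pi_haar [μ.IsMulRightInvariant] {ι : B' → B} (hι : Function.Injective ι)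
    (r : (B → G) → ℝ) (hrc : Continuous r) (hr0 : ∀ U, 0 ≤ r U) :
    ∃ g : (B' → G) → ℝ, Continuous g ∧ (∀ V, 0 ≤ g V) ∧
      (∀ S' : Set (B' → G), MeasurableSet S' →
        ((Measure.pi fun _ : B => μ).withDensity fun U => ENNReal.ofReal (r U)) ((fun U : B → G => U ∘ ι) ⁻¹' S') =
          ∫⁻ V in S', ENNReal.ofReal (g V) ∂(Measure.pi fun _ : B' => μ)) ∧
      ∀ f : (B' → G) → ℝ, Measurable f →
        ∫ U, r U * f (U ∘ ι) ∂(Measure.pi fun _ : B => μ) = ∫ V, g V * f V ∂(Measure.pi fun _ : B' => μ) := by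
  haveI : T2Space G := h.isClosedEmbedding.isEmbedding.t2Space
  haveI := h.secondCountableTopology
  -- `r` is bounded (compact source) and measurable
  obtain ⟨C₀, hC₀⟩ : ∃ C₀ : ℝ, ∀ U : B → G, r U ≤ C₀ := by
    obtain ⟨C₀, hC₀⟩ := isCompact_univ.exists_bound_of_continuousOn hrc.continuousOn
    refine ⟨C₀, fun U => ?_⟩
    have h1 := hC₀ U (mem_univ U)
    rw [Real.norm_eq_abs] at h1
    exact (le_abs_self _).trans h1
  have hMm : Measurable (fun U : B → G => U ∘ ι) := measurable_pi_lambda _ fun b' => measurable_pi_apply (ι b')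
  refine h.exists_continuous_density_pi_haar_of_flatLocalFaces hlie η μ hMm (fun _ => True) isClosed_univ
    (fun U₀ _ => ⟨(continuous_pi fun b' => continuous_apply (ι b')).continuousAt, ?_⟩) r hrc.measurable hr0
    (fun U _ _ => hrc.continuousAt) ⟨C₀, hC₀⟩ (fun U hU => (hU (mem_univ U)).elim)
  exact h.flatFace_chartRead_of_engineFace (M := fun U : B → G => U ∘ ι)
    (Λ' := fun (V : B' → G) (b' : B') => h.logChart (V b' * ((U₀ ∘ ι) b')⁻¹)) (D₀ := (0 : B' → C.lie))
    (Measure.pi fun _ : B => η) (Measure.pi fun _ : B' => η) U₀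
    (by funext b'; simp [h.logChart_one]) (h.flatEngineFace_chartRead_restrict η hι U₀)

end IsChartRep

end Literature.MathematicalPhysics.QuantumFieldTheory.Balaban1983to89.HaarExponentialChart

end
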